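import Summits.Parity.GeneralizedHardyLittlewood.Theorems.GreenTaoLevelTwoMNTwoRecurrentLinearAmplified
import Literature.NumberTheory.Sieve.VinogradovExpSumTools

/-!
# Route `GreenTaoLevelTwo`, crux `MNTwo` (stmt-Parity-21276), line `birth`, stub `stub_mnVertical`:
# bookkeeping for the three applications of Lemma 32 (ii) at the end of Lemma 24 (GT 2008b §10)

Tool for block V4 / H3 (= AIF §10 Lemma 24 "Type II sum implies major arc", last step: "we have
`≳ L²` pairs `(l₁,l₂)` for which this inequality holds for `≳ M` values of `m₁` … apply Lemma 32 (ii)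
… pigeonhole … a single `q ≲ 1` … Applying Lemma 32 (ii) one last time") of the
`stub_mnVertical` census (B. Green, T. Tao, *Quadratic uniformity of the Möbius function*, Ann.
Inst. Fourier 58 (2008) = arXiv:math/0606087, §10).  Def-free, explicit:

* `exists_popular_value` — pigeonholing a bounded `ℕ`-valued function ("a single `q`");
* `card_dense_rows` — from `δ#X#Y` good pairs to `(δ/2)#X` rows with `(δ/2)#Y` good entries;
* `exists_denominator_on_interval` — Lemma 32 (ii)
  (`…MNTwoRecurrentLinearAmplified.exists_norm_mul_le_of_many_small_amplified`) re-indexed to a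
  `ℤ`-interval `[a,b]` with an arbitrary shift `m'` and stated with `distInt`;
* `dense_pairs_step` — one round "dense pairs ⇒ popular denominator on many rows" (the three
  rounds at the end of Lemma 24 are three instances).

References: [GreenTao2008QuadraticMobius] arXiv:math/0606087 §10 (proof of Lemma 24), App. A
Lemma 32 (ii).
-/

noncomputable section

open Finset

namespace Summit.Parity.GeneralizedHardyLittlewood.GreenTaoLevelTwoMNTwoTypeIIHelpers

open Literature.NumberTheory.Sieve.Vinogradov (distInt distInt_eq_norm_coe)
open Summit.Parity.GeneralizedHardyLittlewood.GreenTaoLevelTwoMNTwoRecurrentLinearAmplified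
  (exists_norm_mul_le_of_many_small_amplified)

variable {α β : Type*}

/-- **A popular value**: if `f : A → {1,…,Q}` then some `q ∈ {1,…,Q}` is taken at least `#A/Q`
times. [folklore] -/
theorem exists_popular_value [DecidableEq α] (A : Finset α) (f : α → ℕ) {Q : ℕ} (hQ : 1 ≤ Q)
    (hf : ∀ a ∈ A, f a ∈ Icc 1 Q) :
    ∃ q ∈ Icc 1 Q, (#A : ℝ) / Q ≤ #(A.filter fun a => f a = q) := by
  have hfib : (#A : ℝ) = ∑ q ∈ Icc 1 Q, (#(A.filter fun a => f a = q) : ℝ) := by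
    rw [Finset.card_eq_sum_card_fiberwise (f := f) (t := Icc 1 Q) (fun a ha => hf a ha)]
    push_cast
    rfl
  have hne : (Icc 1 Q).Nonempty := ⟨1, by rw [Finset.mem_Icc]; exact ⟨le_rfl, hQ⟩⟩
  have hQ0 : (Q : ℝ) ≠ 0 := Nat.cast_ne_zero.mpr (by omega)
  have hsum : ∑ _q ∈ Icc 1 Q, (#A : ℝ) / Q ≤ ∑ q ∈ Icc 1 Q, (#(A.filter fun a => f a = q) : ℝ) := by
    rw [← hfib, Finset.sum_const, Nat.card_Icc, Nat.add_sub_cancel, nsmul_eq_mul,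
      mul_div_cancel₀ _ hQ0]
  exact Finset.exists_le_of_sum_le hne hsum

/-- **Dense rows**: if at least `δ·#X·#Y` pairs `(x,y) ∈ X × Y` are good, then at least
`(δ/2)·#X` elements `x ∈ X` have at least `(δ/2)·#Y` good partners `y ∈ Y`. [folklore] -/
theorem card_dense_rows (X : Finset α) (Y : Finset β) (hY : Y.Nonempty) (good : α → β → Prop)
    [∀ x y, Decidable (good x y)] {δ : ℝ} (hδ : 0 ≤ δ)
    (h : δ * #X * #Y ≤ #((X ×ˢ Y).filter fun p => good p.1 p.2)) :
    δ / 2 * #X ≤ #(X.filter fun x => δ / 2 * #Y ≤ #(Y.filter fun y => good x y)) := by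
  have hYpos : (0 : ℝ) < #Y := by exact_mod_cast hY.card_pos
  -- the number of good pairs, fibrewise
  have hfib : (#((X ×ˢ Y).filter fun p => good p.1 p.2) : ℝ) =
      ∑ x ∈ X, (#(Y.filter fun y => good x y) : ℝ) := by
    rw [Finset.card_filter, Finset.sum_product]
    push_cast
    refine Finset.sum_congr rfl fun x _ => ?_
    rw [Finset.card_filter]
    push_cast
    rfl
  rw [hfib] at h
  classical
  -- counting: rows with few good partners contribute little
  set g : α → ℝ := fun x => (#(Y.filter fun y => good x y) : ℝ) with hg
  set G := X.filter fun x => δ / 2 * #Y ≤ g x with hG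
  have hsplit := Finset.sum_filter_add_sum_filter_not X (fun x => δ / 2 * #Y ≤ g x) g
  have h1 : ∑ x ∈ G, g x ≤ #G * #Y := by
    calc ∑ x ∈ G, g x ≤ ∑ _x ∈ G, (#Y : ℝ) :=
          Finset.sum_le_sum fun x _ => by
            simp only [hg]; exact_mod_cast Finset.card_filter_le _ _
      _ = _ := by rw [Finset.sum_const, nsmul_eq_mul]
  have h2 : ∑ x ∈ X.filter (fun x => ¬ δ / 2 * #Y ≤ g x), g x ≤ δ / 2 * #Y * #X := by
    calc ∑ x ∈ X.filter (fun x => ¬ δ / 2 * #Y ≤ g x), g x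
        ≤ ∑ _x ∈ X.filter (fun x => ¬ δ / 2 * #Y ≤ g x), δ / 2 * #Y :=
          Finset.sum_le_sum fun x hx => (not_le.mp (Finset.mem_filter.mp hx).2).le
      _ = #(X.filter (fun x => ¬ δ / 2 * #Y ≤ g x)) * (δ / 2 * #Y) := by
          rw [Finset.sum_const, nsmul_eq_mul]
      _ ≤ #X * (δ / 2 * #Y) :=
          mul_le_mul_of_nonneg_right (by exact_mod_cast Finset.card_filter_le _ _) (by positivity)
      _ = _ := by ring
  have h3 : δ * #X * #Y ≤ ∑ x ∈ X, g x := h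
  rw [← hsplit] at h3
  have h4 : δ / 2 * #X * #Y ≤ #G * #Y := by linarith
  exact le_of_mul_le_mul_right h4 hYpos

/-- **Lemma 32 (ii) on a `ℤ`-interval with a shift.**  Let `[a,b] ⊂ ℤ` have `N = b − a + 1 ≥ 1`
elements, `0 < δ₂ ≤ 1`, `0 ≤ δ₁ ≤ δ₂/4`, `2 < δ₂²N`.  If at least `δ₂N` integers `m ∈ [a,b]` have
`‖α(m − m')‖_{ℝ/ℤ} ≤ δ₁`, then some `1 ≤ q ≤ 6418/δ₂²` has `‖qα‖_{ℝ/ℤ} ≤ 2630455808·δ₁/(δ₂⁶N)`.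
[cite: GreenTao2008QuadraticMobius, App. A Lemma 32 (ii)] -/
theorem exists_denominator_on_interval (α : ℝ) {a b : ℤ} (hab : a ≤ b) (m' : ℤ) {δ₁ δ₂ : ℝ}
    (hδ₂ : 0 < δ₂) (hδ₂1 : δ₂ ≤ 1) (hδ₁ : 0 ≤ δ₁) (hδ₁₂ : δ₁ ≤ δ₂ / 4)
    (hN : 2 < δ₂ ^ 2 * ((b - a + 1 : ℤ) : ℝ))
    (hcount : δ₂ * ((b - a + 1 : ℤ) : ℝ) ≤
      #((Icc a b).filter fun m : ℤ => distInt (α * ((m - m' : ℤ) : ℝ)) ≤ δ₁)) :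
    ∃ q : ℕ, 1 ≤ q ∧ (q : ℝ) ≤ 6418 / δ₂ ^ 2 ∧
      distInt (q * α) ≤ 2630455808 * δ₁ / (δ₂ ^ 6 * ((b - a + 1 : ℤ) : ℝ)) := by
  set k : ℕ := (b - a + 1).toNat with hk
  have hk' : ((k : ℕ) : ℤ) = b - a + 1 := Int.toNat_of_nonneg (by omega)
  have hkr : (k : ℝ) = ((b - a + 1 : ℤ) : ℝ) := by exact_mod_cast hk'
  -- reindex `[a,b] = {a - 1 + l : 1 ≤ l ≤ k}`; then `m - m' = M + l` with `M = a - 1 - m'`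
  set emb : ℕ ↪ ℤ := ⟨fun n => a - 1 + n, fun n n' h => by simpa using h⟩ with hemb
  have hmap : (Icc 1 k).map emb = Icc a b := by
    ext m
    simp only [Finset.mem_map, Finset.mem_Icc, hemb, Function.Embedding.coeFn_mk]
    constructor
    · rintro ⟨n, ⟨h1, h2⟩, rfl⟩
      constructor <;> omega
    · rintro ⟨h1, h2⟩
      exact ⟨(m - a + 1).toNat, ⟨by omega, by omega⟩, by omega⟩
  set M : ℤ := a - 1 - m' with hM
  have hcount' : δ₂ * k ≤ #((Icc 1 k).filter fun l : ℕ =>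
      ‖((α * ((M : ℝ) + l) : ℝ) : UnitAddCircle)‖ ≤ δ₁) := by
    rw [hkr]
    refine hcount.trans (le_of_eq ?_)
    rw [← hmap, Finset.filter_map, Finset.card_map]
    congr 2
    ext l
    simp only [Finset.mem_filter, Function.comp_apply, hemb, Function.Embedding.coeFn_mk,
      distInt_eq_norm_coe, hM]
    push_cast
    ring_nf
  obtain ⟨q, hq1, hqQ, hqα⟩ :=
    exists_norm_mul_le_of_many_small_amplified α M hδ₂ hδ₂1 hδ₁ hδ₁₂ (by rw [hkr]; exact hN) hcount'
  refine ⟨q, hq1, hqQ, ?_⟩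
  rw [distInt_eq_norm_coe, ← hkr]
  exact hqα

/-- **One round of "dense pairs ⇒ a popular denominator on many rows"** (the pattern applied three
times at the end of the proof of Lemma 24).  Let `X` be a finite nonempty set of parameters,
`[a,b] ⊂ ℤ` an interval with `n = b − a + 1` elements, `α : X → ℝ`, `m' ∈ ℤ`, `0 < δ ≤ 1`,
`0 ≤ δ₁ ≤ δ/8`, `2 < (δ/2)²n`.  If at least `δ·#X·n` pairs `(x,m) ∈ X × [a,b]` have
`‖α(x)(m − m')‖_{ℝ/ℤ} ≤ δ₁`, then there is `1 ≤ q ≤ 25672/δ²` such that at least `(δ³/51344)·#X`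
parameters `x ∈ X` satisfy `‖q α(x)‖_{ℝ/ℤ} ≤ 2630455808·64·δ₁/(δ⁶ n)`.
[cite: GreenTao2008QuadraticMobius, §10 (proof of Lemma 24, last step) and App. A Lemma 32 (ii)] -/
theorem dense_pairs_step [DecidableEq α] (X : Finset α) {a b : ℤ} (hab : a ≤ b)
    (αf : α → ℝ) (m' : ℤ) {δ δ₁ : ℝ} (hδ : 0 < δ) (hδ1 : δ ≤ 1) (hδ₁ : 0 ≤ δ₁)
    (hδ₁δ : δ₁ ≤ δ / 8) (hn : 2 < (δ / 2) ^ 2 * ((b - a + 1 : ℤ) : ℝ))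
    (h : δ * #X * ((b - a + 1 : ℤ) : ℝ) ≤
      #((X ×ˢ Icc a b).filter fun p => distInt (αf p.1 * ((p.2 - m' : ℤ) : ℝ)) ≤ δ₁)) :
    ∃ q : ℕ, 1 ≤ q ∧ (q : ℝ) ≤ 25672 / δ ^ 2 ∧
      δ ^ 3 / 51344 * #X ≤ #(X.filter fun x =>
        distInt (q * αf x) ≤ 2630455808 * 64 * δ₁ / (δ ^ 6 * ((b - a + 1 : ℤ) : ℝ))) := by
  classical
  have hT : (Icc a b).Nonempty := ⟨a, by rw [Finset.mem_Icc]; exact ⟨le_rfl, hab⟩⟩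
  have hNeq : (#(Icc a b) : ℝ) = ((b - a + 1 : ℤ) : ℝ) := by
    rw [Int.card_Icc]
    have : (((b + 1 - a).toNat : ℕ) : ℤ) = b - a + 1 := by
      rw [Int.toNat_of_nonneg (by omega)]; ring
    exact_mod_cast this
  have hnpos : (0 : ℝ) < ((b - a + 1 : ℤ) : ℝ) := by rw [← hNeq]; exact_mod_cast hT.card_pos
  -- Step 1: dense rows
  have hrows := card_dense_rows X (Icc a b) hT
    (fun x m => distInt (αf x * ((m - m' : ℤ) : ℝ)) ≤ δ₁) hδ.le (by rw [hNeq]; exact h)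
  rw [hNeq] at hrows
  set G := X.filter fun x => δ / 2 * ((b - a + 1 : ℤ) : ℝ) ≤
    #((Icc a b).filter fun m => distInt (αf x * ((m - m' : ℤ) : ℝ)) ≤ δ₁) with hG
  -- Step 2: a denominator for each good row
  have hδ2 : 0 < δ / 2 := by linarith
  have hδ21 : δ / 2 ≤ 1 := by linarith
  have hδ₁' : δ₁ ≤ δ / 2 / 4 := by linarith
  have hden : ∀ x ∈ G, ∃ q : ℕ, 1 ≤ q ∧ (q : ℝ) ≤ 6418 / (δ / 2) ^ 2 ∧
      distInt (q * αf x) ≤ 2630455808 * δ₁ / ((δ / 2) ^ 6 * ((b - a + 1 : ℤ) : ℝ)) := by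
    intro x hx
    rw [hG, Finset.mem_filter] at hx
    exact exists_denominator_on_interval (αf x) hab m' hδ2 hδ21 hδ₁ hδ₁' hn hx.2
  choose! qf hqf1 hqfQ hqfd using hden
  -- Step 3: a popular denominator
  set Q : ℕ := ⌊25672 / δ ^ 2⌋₊ with hQ
  have hQr : (25672 : ℝ) ≤ 25672 / δ ^ 2 := by
    rw [le_div_iff₀ (by positivity)]
    have : δ ^ 2 ≤ 1 := by nlinarith
    nlinarith
  have hQ1 : 1 ≤ Q := by
    rw [hQ]; exact Nat.le_floor (by norm_num; linarith)
  have hQle : (Q : ℝ) ≤ 25672 / δ ^ 2 := Nat.floor_le (by positivity)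
  have hQpos : (0 : ℝ) < Q := by exact_mod_cast hQ1
  have hqfmem : ∀ x ∈ G, qf x ∈ Icc 1 Q := by
    intro x hx
    rw [Finset.mem_Icc]
    refine ⟨hqf1 x hx, ?_⟩
    rw [hQ]
    refine Nat.le_floor ?_
    refine (hqfQ x hx).trans (le_of_eq ?_)
    field_simp
    norm_num
  obtain ⟨q₀, hq₀, hpop⟩ := exists_popular_value G qf hQ1 hqfmem
  rw [Finset.mem_Icc] at hq₀
  refine ⟨q₀, hq₀.1, (show (q₀ : ℝ) ≤ Q by exact_mod_cast hq₀.2).trans hQle, ?_⟩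
  -- the popular class is contained in the target set
  have hsub : G.filter (fun x => qf x = q₀) ⊆ X.filter fun x =>
      distInt (q₀ * αf x) ≤ 2630455808 * 64 * δ₁ / (δ ^ 6 * ((b - a + 1 : ℤ) : ℝ)) := by
    intro x hx
    rw [Finset.mem_filter] at hx ⊢
    have hxG := hx.1
    refine ⟨(Finset.mem_filter.mp hxG).1, ?_⟩
    rw [← hx.2]
    refine (hqfd x hxG).trans (le_of_eq ?_)
    field_simp
    ring
  have hcardG : δ / 2 * #X ≤ #G := hrows
  calc δ ^ 3 / 51344 * #X = (δ / 2 * #X) / (25672 / δ ^ 2) := by field_simp; ring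
    _ ≤ (#G : ℝ) / (25672 / δ ^ 2) := by
        exact div_le_div_of_nonneg_right hcardG (by positivity)
    _ ≤ (#G : ℝ) / Q := by
        exact div_le_div_of_nonneg_left (Nat.cast_nonneg _) hQpos hQle
    _ ≤ #(G.filter fun x => qf x = q₀) := hpop
    _ ≤ _ := by exact_mod_cast Finset.card_le_card hsub

end Summit.Parity.GeneralizedHardyLittlewood.GreenTaoLevelTwoMNTwoTypeIIHelpers
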